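import Summits.Ventures.PercRepro.C025ProfileHallParallel

/-!
# C-032 / C-033 — THE DOUBLE COUNT FOR AN ARBITRARY PER-PAIR CERTIFICATE (night-3 g9)

Every row `(q,u)` of the profile inequality `(Π_{q,u})` (C-032) and of its Hall form `(H⁺_{q,u})` (C-033) proved so
far in this tree (the rows `q = 0`, `q = 1`, `(2,3)`) is proved by a **local certificate**: a weight `W(B,S) ≥ 0` on
the pairs `B ⊆ S` (`ρ(B) = q`, `ρ(S) = u`) with

* (Cap) `Σ_{B ⊆ S} W(B,S) ≤ 1` for every rank-`u` set `S`, and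
* (Dem) `price(B) ≤ Σ_{S ⊇ B} W(B,S)` for every rank-`q` set `B`,

and the double count `Σ_B price(B) ≤ Σ_B Σ_{S ⊇ B} W = Σ_S Σ_{B ⊆ S} W ≤ #{S : ρ(S) = u}`. The row `(2,3)` states it for
its own rule (`profileIneq_two_three_of_certG`, capacity `3` and demand `ρ(E∖B)` — the same count after scaling by
`3`). This module states the double count ONCE, for an arbitrary weight function and every `(q,u)`, in the capacity-`1`
normalisation of the lab (`price M q u B = C(ρ(E∖B)+q, u)/C(ρ(E∖B)+q, q)` when `u ≤ ρ(E∖B)`, else `0`):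

* `profileIneq_of_cert` — (Cap) ∧ (Dem) ⟹ `Profile.ProfileIneq M q u`;
* `hallIneq_of_cert` — (Cap) ∧ (Dem) ⟹ `Profile.HallIneq M q u` (the capacity side only drops nonnegative terms when
  restricted to a family, so a per-pair certificate gives the Hall form for free — the remark of
  NIGHT3-G8-GENERAL-CERTIFICATE.md §7 in general);
* `profileIneq_of_hallIneq` — the Hall form at `𝒜 = Rq M q` is the profile inequality.

Nothing here depends on the values of the rule; the rows `(2,u)`, `u ≥ 4`, are to be proved by exhibiting their rules
and checking (Cap) / (Dem) — the lane's next step. No rank, simplicity or size hypothesis is needed.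
-/

open scoped Matroid

namespace PercRepro

open Set Finset

section CertBridge

variable {α : Type} [DecidableEq α] {M : Matroid α} [M.Finite]

/-- **The double count for an arbitrary certificate**: a weight `W ≥ 0` on the pairs `(B, S)` with (Cap) on every
rank-`u` set and (Dem) on every rank-`q` set gives the profile inequality `(Π_{q,u})` of `M`. -/
theorem profileIneq_of_cert (q u : ℕ) (W : Finset α → Finset α → ℚ)
    (hCap : ∀ S ∈ Shadow.levelSet M u, ∑ B ∈ (Profile.Rq M q).filter (fun B => B ⊆ S), W B S ≤ 1)
    (hDem : ∀ B ∈ Profile.Rq M q,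
      Profile.price M q u B ≤ ∑ S ∈ (Shadow.levelSet M u).filter (fun S => B ⊆ S), W B S) :
    Profile.ProfileIneq M q u := by
  unfold Profile.ProfileIneq
  have hswap : ∑ B ∈ Profile.Rq M q, ∑ S ∈ (Shadow.levelSet M u).filter (fun S => B ⊆ S), W B S =
      ∑ S ∈ Shadow.levelSet M u, ∑ B ∈ (Profile.Rq M q).filter (fun B => B ⊆ S), W B S := by
    apply Finset.sum_comm'
    intro B S
    simp only [Finset.mem_filter]
    tauto
  have h1 : ∑ B ∈ Profile.Rq M q, Profile.price M q u B ≤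
      ∑ B ∈ Profile.Rq M q, ∑ S ∈ (Shadow.levelSet M u).filter (fun S => B ⊆ S), W B S :=
    Finset.sum_le_sum hDem
  have h2 : ∑ S ∈ Shadow.levelSet M u, ∑ B ∈ (Profile.Rq M q).filter (fun B => B ⊆ S), W B S ≤
      ∑ _S ∈ Shadow.levelSet M u, (1 : ℚ) := Finset.sum_le_sum hCap
  rw [Finset.sum_const, nsmul_eq_mul, mul_one] at h2
  rw [hswap] at h1
  linarith

/-- **The double count for a family**: the same (Cap) ∧ (Dem) give the Hall inequality `(H⁺_{q,u})` of `M` — on a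
family `𝒜` the capacity side only loses the nonnegative terms of the members outside `𝒜`. -/
theorem hallIneq_of_cert (q u : ℕ) (W : Finset α → Finset α → ℚ) (hW : ∀ B S, 0 ≤ W B S)
    (hCap : ∀ S ∈ Shadow.levelSet M u, ∑ B ∈ (Profile.Rq M q).filter (fun B => B ⊆ S), W B S ≤ 1)
    (hDem : ∀ B ∈ Profile.Rq M q,
      Profile.price M q u B ≤ ∑ S ∈ (Shadow.levelSet M u).filter (fun S => B ⊆ S), W B S) :
    Profile.HallIneq M q u := by
  intro 𝒜 h𝒜
  have hswap : ∑ B ∈ 𝒜, ∑ S ∈ (Shadow.levelSet M u).filter (fun S => B ⊆ S), W B S =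
      ∑ S ∈ Shadow.shadowLevel M u 𝒜, ∑ B ∈ 𝒜.filter (fun B => B ⊆ S), W B S := by
    apply Finset.sum_comm'
    intro B S
    simp only [Finset.mem_filter, mem_shadowLevel]
    constructor
    · rintro ⟨hB, hS, hBS⟩
      exact ⟨⟨hB, hBS⟩, hS, B, hB, hBS⟩
    · rintro ⟨⟨hB, hBS⟩, hS, _⟩
      exact ⟨hB, hS, hBS⟩
  have h1 : ∑ B ∈ 𝒜, Profile.price M q u B ≤
      ∑ B ∈ 𝒜, ∑ S ∈ (Shadow.levelSet M u).filter (fun S => B ⊆ S), W B S :=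
    Finset.sum_le_sum (fun B hB => hDem B (h𝒜 hB))
  have h2 : ∑ S ∈ Shadow.shadowLevel M u 𝒜, ∑ B ∈ 𝒜.filter (fun B => B ⊆ S), W B S ≤
      ∑ _S ∈ Shadow.shadowLevel M u 𝒜, (1 : ℚ) := by
    apply Finset.sum_le_sum
    intro S hS
    rw [mem_shadowLevel] at hS
    calc ∑ B ∈ 𝒜.filter (fun B => B ⊆ S), W B S
        ≤ ∑ B ∈ (Profile.Rq M q).filter (fun B => B ⊆ S), W B S := by
          apply Finset.sum_le_sum_of_subset_of_nonneg
          · intro B hB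
            rw [Finset.mem_filter] at hB ⊢
            exact ⟨h𝒜 hB.1, hB.2⟩
          · intro B _ _
            exact hW B S
      _ ≤ 1 := hCap S hS.1
  rw [Finset.sum_const, nsmul_eq_mul, mul_one] at h2
  rw [hswap] at h1
  linarith

/-- The Hall inequality at the full family `Rq M q` is the profile inequality. -/
theorem profileIneq_of_hallIneq (q u : ℕ) (h : Profile.HallIneq M q u) : Profile.ProfileIneq M q u := by
  unfold Profile.ProfileIneq
  have h1 := h (Profile.Rq M q) (Finset.Subset.refl _)
  have h2 : (Shadow.shadowLevel M u (Profile.Rq M q)).card ≤ (Shadow.levelSet M u).card := by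
    apply Finset.card_le_card
    intro S hS
    exact ((mem_shadowLevel).1 hS).1
  exact h1.trans (by exact_mod_cast h2)

end CertBridge

end PercRepro
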